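import Summits.HodgeConjecture.HodgeConjecture.Theorems.LinearSystemTorelliLocalTubeSpanSp2Closure
import Summits.HodgeConjecture.HodgeConjecture.Theorems.LinearSystemTorelliLocalTubeSpanLatticeCoordinates
import Summits.HodgeConjecture.HodgeConjecture.Theorems.LinearSystemTorelliLocalTubeSpanUnimodularTransitivityLocal
import Summits.HodgeConjecture.HodgeConjecture.Theorems.LinearSystemTorelliLocalTubeSpanThreeSquares

/-!
# Route LinearSystemTorelli — crux `LocalTubeSpan` (stmt-HodgeConjecture-2490): THEOREM U, the descent step

Helper file of line `Sketch`, cycle 9 (continuation lead c7), for THEOREM U ("the level-2 congruence subgroup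
of a lattice unimodular modulo its radical is generated by squares of transvections").  Let `Λ = ℤS` be a
finitely generated lattice spanning the `ℚ`-space `V`, with the alternating form `B` integral on `S`, and let
`G ≤ GL(V)` contain a unit acting as `T_a² : v ↦ v - 2⟨v,a⟩a` for every `a ∈ Λ`.  Write `K = Sp♯₂(Λ)` for
the units satisfying the four hypotheses of `Janssen1983_thm2_5` (isometry, preserving `Λ` both ways,
Schnell's displayed condition).

* `localTubeSpan_theoremU_step` — THE STEP OF THE MULTI-PLANE DESCENT: given vectors `u₁,w₁,…,u_k,w_k ∈ Λ`
  fixed by `g ∈ K`, and a unimodular pair `x, y ∈ Λ` (`⟨x,y⟩ = 1`) orthogonal to all of them, there is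
  `h ∈ G ∩ K` fixing the `uᵢ, wᵢ` with `h⁻¹g` fixing `x` and `y` as well.  (Cycle 8's descent, run inside
  the subgroup of `G ∩ K` fixing the `uᵢ, wᵢ`, with the lattice `Λ' = Λ ∩ {uᵢ,wᵢ}^⊥` in place of `ℤΔ`: the
  squares along `a ∈ Λ'` fix the `uᵢ, wᵢ`, three squares make the pair moves (`…ThreeSquares`), and `g x - x`,
  `g y - y` have coordinates in `2Λ'`.)

No named facts; no `sorry`.
-/

-- `Summit.HodgeConjecture.HodgeConjecture.Theorems` is the mandated namespace (single-conjunct summit: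
-- Sub = Summit), which `linter.dupNamespace` flags on every declaration; the lakefile turns the
-- linter off tree-wide (weak option), restated here so stand-alone elaboration is warning-free too.
set_option linter.dupNamespace false

noncomputable section

open Literature.AlgebraicGeometry.HodgeTheory

namespace Summit.HodgeConjecture.HodgeConjecture.Theorems

variable {V : Type} [AddCommGroup V] [Module ℚ V]

/-- **Theorem U, the descent step.**  `Λ = ℤS` finitely generated, spanning, `B` alternating and integral on
`S`; `G` contains a unit acting as `T_a²` for every `a ∈ Λ`; `uu i, ww i ∈ Λ` (`i < k`) are fixed by the unit
`g`, which satisfies the four `Sp♯₂(Λ)` conditions; `x, y ∈ Λ` with `⟨x, y⟩ = 1` are orthogonal to all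
`uu i, ww i`.  Then some `h ∈ G` satisfying the four conditions and fixing all `uu i, ww i` has `h⁻¹ g`
fixing `x` and `y`. [cite: Janssen1983, Thm. 2.5] -/
theorem localTubeSpan_theoremU_step [FiniteDimensional ℚ V] (B : LinearMap.BilinForm ℚ V)
    (hB : B.IsAlt) (S : Set V) (hint : ∀ δ ∈ S, ∀ δ' ∈ S, ∃ n : ℤ, B δ δ' = n)
    (hfg : (Submodule.span ℤ S).FG) (hsp : Submodule.span ℚ S = ⊤)
    (G : Subgroup (V →ₗ[ℚ] V)ˣ)
    (hsq : ∀ a ∈ Submodule.span ℤ S, ∃ g ∈ G, ∀ v : V,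
      ((g : (V →ₗ[ℚ] V)ˣ) : V →ₗ[ℚ] V) v = v - (2 : ℚ) • (B v a • a))
    {k : ℕ} (uu ww : Fin k → V)
    {x y : V} (hx : x ∈ Submodule.span ℤ S) (hy : y ∈ Submodule.span ℤ S) (hxy : B x y = 1)
    (hxo : ∀ i, B (uu i) x = 0 ∧ B (ww i) x = 0) (hyo : ∀ i, B (uu i) y = 0 ∧ B (ww i) y = 0)
    (g : (V →ₗ[ℚ] V)ˣ)
    (h1 : ∀ a b : V, B ((g : V →ₗ[ℚ] V) a) ((g : V →ₗ[ℚ] V) b) = B a b)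
    (h2 : ∀ a ∈ Submodule.span ℤ S, (g : V →ₗ[ℚ] V) a ∈ Submodule.span ℤ S)
    (h3 : ∀ a ∈ Submodule.span ℤ S, ((g⁻¹ : (V →ₗ[ℚ] V)ˣ) : V →ₗ[ℚ] V) a ∈ Submodule.span ℤ S)
    (h4 : ∀ l : V →ₗ[ℚ] ℚ, (∀ a ∈ Submodule.span ℤ S, ∃ z : ℤ, l a = z) →
      ∃ v ∈ Submodule.span ℤ S, ∀ a ∈ Submodule.span ℤ S, l ((g : V →ₗ[ℚ] V) a - a) = 2 * B v a)
    (hfix : ∀ i, (g : V →ₗ[ℚ] V) (uu i) = uu i ∧ (g : V →ₗ[ℚ] V) (ww i) = ww i) :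
    ∃ h ∈ G,
      ((∀ a b : V, B ((h : V →ₗ[ℚ] V) a) ((h : V →ₗ[ℚ] V) b) = B a b) ∧
        (∀ a ∈ Submodule.span ℤ S, (h : V →ₗ[ℚ] V) a ∈ Submodule.span ℤ S) ∧
        (∀ a ∈ Submodule.span ℤ S, ((h⁻¹ : (V →ₗ[ℚ] V)ˣ) : V →ₗ[ℚ] V) a ∈ Submodule.span ℤ S) ∧
        (∀ l : V →ₗ[ℚ] ℚ, (∀ a ∈ Submodule.span ℤ S, ∃ z : ℤ, l a = z) →
          ∃ v ∈ Submodule.span ℤ S, ∀ a ∈ Submodule.span ℤ S,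
            l ((h : V →ₗ[ℚ] V) a - a) = 2 * B v a)) ∧
      (∀ i, (h : V →ₗ[ℚ] V) (uu i) = uu i ∧ (h : V →ₗ[ℚ] V) (ww i) = ww i) ∧
      ((h⁻¹ * g : (V →ₗ[ℚ] V)ˣ) : V →ₗ[ℚ] V) x = x ∧ ((h⁻¹ * g : (V →ₗ[ℚ] V)ˣ) : V →ₗ[ℚ] V) y = y := by
  classical
  have hyx : B y x = -1 := by rw [← hB.neg_eq, hxy]
  -- the `Sp♯₂` conditions as a predicate, closed under the group operations
  let C : (V →ₗ[ℚ] V)ˣ → Prop := fun g =>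
    (∀ a b : V, B ((g : V →ₗ[ℚ] V) a) ((g : V →ₗ[ℚ] V) b) = B a b) ∧
    (∀ a ∈ Submodule.span ℤ S, (g : V →ₗ[ℚ] V) a ∈ Submodule.span ℤ S) ∧
    (∀ a ∈ Submodule.span ℤ S, ((g⁻¹ : (V →ₗ[ℚ] V)ˣ) : V →ₗ[ℚ] V) a ∈ Submodule.span ℤ S) ∧
    (∀ l : V →ₗ[ℚ] ℚ, (∀ a ∈ Submodule.span ℤ S, ∃ z : ℤ, l a = z) →
      ∃ v ∈ Submodule.span ℤ S, ∀ a ∈ Submodule.span ℤ S,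
        l ((g : V →ₗ[ℚ] V) a - a) = 2 * B v a)
  have hCmul : ∀ g h, C g → C h → C (g * h) := fun g h hg hh =>
    localTubeSpan_sp2Cond_mul B S g h hg.1 hg.2.1 hg.2.2.1 hg.2.2.2 hh.1 hh.2.1 hh.2.2.1 hh.2.2.2
  have hCinv : ∀ g, C g → C g⁻¹ := fun g hg =>
    localTubeSpan_sp2Cond_inv B S g hg.1 hg.2.1 hg.2.2.1 hg.2.2.2
  have hCone : C 1 := localTubeSpan_sp2Cond_one B S
  have hCsq : ∀ a ∈ Submodule.span ℤ S, ∀ g : (V →ₗ[ℚ] V)ˣ,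
      (∀ v, (g : V →ₗ[ℚ] V) v = v - (2 : ℚ) • (B v a • a)) → C g := fun a ha g hg =>
    localTubeSpan_sp2Cond_of_sqMove B S hB hint ha g hg
  have hCpair : ∀ e ∈ Submodule.span ℤ S, ∀ f ∈ Submodule.span ℤ S, B e f = 0 →
      ∀ g : (V →ₗ[ℚ] V)ˣ, (∀ v, (g : V →ₗ[ℚ] V) v = v + (2 : ℚ) • (B v e • f + B v f • e)) → C g :=
    fun e he f hf hef g hg => localTubeSpan_sp2Cond_of_pairMove B S hB hint he hf hef g hg
  -- "fixes the family"
  let F : (V →ₗ[ℚ] V)ˣ → Prop := fun g => ∀ i, (g : V →ₗ[ℚ] V) (uu i) = uu i ∧ (g : V →ₗ[ℚ] V) (ww i) = ww i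
  have hFmul : ∀ g h, F g → F h → F (g * h) := fun g h hg hh i =>
    ⟨by rw [Units.val_mul, Module.End.mul_apply, (hh i).1, (hg i).1],
     by rw [Units.val_mul, Module.End.mul_apply, (hh i).2, (hg i).2]⟩
  have hFinv : ∀ g, F g → F g⁻¹ := fun g hg i =>
    ⟨by conv_lhs => rw [← (hg i).1]
        rw [localTubeSpan_units_inv_apply_apply],
     by conv_lhs => rw [← (hg i).2]
        rw [localTubeSpan_units_inv_apply_apply]⟩
  have hFone : F 1 := fun i => ⟨by rw [Units.val_one, Module.End.one_apply],
    by rw [Units.val_one, Module.End.one_apply]⟩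
  -- the local subgroup `G ⊓ Sp♯₂ ⊓ Fix(family)`
  let ΓK : Subgroup (V →ₗ[ℚ] V)ˣ :=
    { carrier := {g | g ∈ G ∧ C g ∧ F g}
      one_mem' := ⟨one_mem _, hCone, hFone⟩
      mul_mem' := fun {a b} ha hb => ⟨mul_mem ha.1 hb.1, hCmul a b ha.2.1 hb.2.1, hFmul a b ha.2.2 hb.2.2⟩
      inv_mem' := fun {a} ha => ⟨inv_mem ha.1, hCinv a ha.2.1, hFinv a ha.2.2⟩ }
  have hΓK : ∀ {g}, g ∈ ΓK ↔ g ∈ G ∧ C g ∧ F g := fun {g} => Iff.rfl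
  -- the sublattice `Λ' = Λ ∩ {uu i, ww i}^⊥` (as a set; it is a `ℤ`-submodule)
  let L : Set V := {a | a ∈ Submodule.span ℤ S ∧ ∀ i, B (uu i) a = 0 ∧ B (ww i) a = 0}
  have hLspan : ∀ a ∈ Submodule.span ℤ L, a ∈ Submodule.span ℤ S ∧ ∀ i, B (uu i) a = 0 ∧ B (ww i) a = 0 := by
    intro a ha
    induction ha using Submodule.span_induction with
    | mem a ha => exact ha
    | zero => exact ⟨Submodule.zero_mem _, fun i => ⟨map_zero _, map_zero _⟩⟩
    | add a b _ _ iha ihb =>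
      exact ⟨Submodule.add_mem _ iha.1 ihb.1, fun i => ⟨by rw [map_add, (iha.2 i).1, (ihb.2 i).1, add_zero],
        by rw [map_add, (iha.2 i).2, (ihb.2 i).2, add_zero]⟩⟩
    | smul n a _ iha =>
      exact ⟨Submodule.smul_mem _ _ iha.1, fun i => ⟨by rw [map_zsmul, (iha.2 i).1, smul_zero],
        by rw [map_zsmul, (iha.2 i).2, smul_zero]⟩⟩
  have hintL : ∀ δ ∈ L, ∀ δ' ∈ L, ∃ n : ℤ, B δ δ' = n := fun δ hδ δ' hδ' =>
    localTubeSpan_integral_span B S hint hδ.1 hδ'.1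
  have hxL : x ∈ L := ⟨hx, hxo⟩
  have hyL : y ∈ L := ⟨hy, hyo⟩
  have hxyL : x + y ∈ L := ⟨Submodule.add_mem _ hx hy, fun i =>
    ⟨by rw [map_add, (hxo i).1, (hyo i).1, add_zero], by rw [map_add, (hxo i).2, (hyo i).2, add_zero]⟩⟩
  -- squares along vectors of `Λ'` lie in `ΓK`
  have hsqL : ∀ a ∈ L, ∃ q ∈ ΓK, ∀ v : V, ((q : (V →ₗ[ℚ] V)ˣ) : V →ₗ[ℚ] V) v = v - (2 : ℚ) • (B v a • a) := by
    intro a ha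
    obtain ⟨q, hq, hqv⟩ := hsq a ha.1
    refine ⟨q, hΓK.2 ⟨hq, hCsq a ha.1 q hqv, fun i => ⟨?_, ?_⟩⟩, hqv⟩
    · rw [hqv, (ha.2 i).1, zero_smul, smul_zero, sub_zero]
    · rw [hqv, (ha.2 i).2, zero_smul, smul_zero, sub_zero]
  -- pair moves along `e ∈ Λ'` with `f ∈ Λ'`, `e ⟂ f`, lie in `ΓK` (three squares)
  have hpairL : ∀ e ∈ L, ∀ f ∈ L, B e f = 0 →
      ∃ p ∈ ΓK, ∀ v : V, ((p : (V →ₗ[ℚ] V)ˣ) : V →ₗ[ℚ] V) v = v + (2 : ℚ) • (B v e • f + B v f • e) := by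
    intro e he f hf hef
    have hefL : e + f ∈ L := ⟨Submodule.add_mem _ he.1 hf.1, fun i =>
      ⟨by rw [map_add, (he.2 i).1, (hf.2 i).1, add_zero], by rw [map_add, (he.2 i).2, (hf.2 i).2, add_zero]⟩⟩
    obtain ⟨ge, hge, hgev⟩ := hsqL e he
    obtain ⟨gf, hgf, hgfv⟩ := hsqL f hf
    obtain ⟨gef, hgef, hgefv⟩ := hsqL (e + f) hefL
    exact ⟨ge * gf * gef⁻¹, mul_mem (mul_mem hge hgf) (inv_mem hgef),
      localTubeSpan_threeSquares B hB hef ge gf gef hgev hgfv hgefv⟩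
  have hpairK : ∀ e ∈ ({x, y} : Set V), ∀ f ∈ Submodule.span ℤ L, B e f = 0 →
      ∃ p ∈ ΓK, ∀ v : V, ((p : (V →ₗ[ℚ] V)ˣ) : V →ₗ[ℚ] V) v = v + (2 : ℚ) • (B v e • f + B v f • e) := by
    intro e he f hf hef
    have hfL : f ∈ L := hLspan f hf
    simp only [Set.mem_insert_iff, Set.mem_singleton_iff] at he
    rcases he with rfl | rfl
    · exact hpairL e hxL f hfL hef
    · exact hpairL e hyL f hfL hef
  have hsqK : ∀ a ∈ ({x, y, x + y} : Set V), ∃ q ∈ ΓK, ∀ v : V,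
      ((q : (V →ₗ[ℚ] V)ˣ) : V →ₗ[ℚ] V) v = v - (2 : ℚ) • (B v a • a) := by
    intro a ha
    simp only [Set.mem_insert_iff, Set.mem_singleton_iff] at ha
    have haL : a ∈ L := by rcases ha with rfl | rfl | rfl <;> assumption
    exact hsqL a haL
  -- vectors of `Λ` orthogonal to the family with even coordinates are twice a vector of `Λ'`
  have hhalfL : ∀ g' : (V →ₗ[ℚ] V)ˣ, C g' → F g' → ∀ a ∈ L,
      ∃ z ∈ Submodule.span ℤ L, (g' : V →ₗ[ℚ] V) a - a = (2 : ℚ) • z := by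
    intro g' hg' hFg' a ha
    obtain ⟨z, hz, hze⟩ := localTubeSpan_exists_half_of_even S hfg hsp
      (localTubeSpan_even_of_sp2 B S hint g' hg'.2.2.2 ha.1)
    have hzL : z ∈ L := by
      refine ⟨hz, fun i => ⟨?_, ?_⟩⟩
      · have h0 : B (uu i) ((g' : V →ₗ[ℚ] V) a - a) = 0 := by
          rw [map_sub, (ha.2 i).1]
          conv_lhs => rw [← (hFg' i).1, hg'.1, (ha.2 i).1]
          rw [sub_self]
        rw [hze, map_smul, smul_eq_mul] at h0
        linarith
      · have h0 : B (ww i) ((g' : V →ₗ[ℚ] V) a - a) = 0 := by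
          rw [map_sub, (ha.2 i).2]
          conv_lhs => rw [← (hFg' i).2, hg'.1, (ha.2 i).2]
          rw [sub_self]
        rw [hze, map_smul, smul_eq_mul] at h0
        linarith
    exact ⟨z, Submodule.subset_span hzL, hze⟩
  have hgC : C g := ⟨h1, h2, h3, h4⟩
  -- Step 1: move `g x` back to `x`
  obtain ⟨z₁, hz₁, hz₁e⟩ := hhalfL g hgC hfix x hxL
  have ht : ∃ z ∈ Submodule.span ℤ L, (g : V →ₗ[ℚ] V) x = x + (2 : ℚ) • z :=
    ⟨z₁, hz₁, by rw [← hz₁e, add_sub_cancel]⟩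
  have hgyL : (g : V →ₗ[ℚ] V) y ∈ L := by
    refine ⟨h2 y hy, fun i => ⟨?_, ?_⟩⟩
    · conv_lhs => rw [← (hfix i).1, h1, (hyo i).1]
    · conv_lhs => rw [← (hfix i).2, h1, (hyo i).2]
  have htu : ∃ y' ∈ Submodule.span ℤ L, B ((g : V →ₗ[ℚ] V) x) y' = 1 :=
    ⟨(g : V →ₗ[ℚ] V) y, Submodule.subset_span hgyL, by rw [h1, hxy]⟩
  obtain ⟨k₁, hk₁, hk₁x⟩ := localTubeSpan_unimodularTransitivity_local B hB L hintL ΓK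
    (Submodule.subset_span hxL) (Submodule.subset_span hyL) hxy hpairK hsqK ht htu
  obtain ⟨hk₁G, hk₁C, hk₁F⟩ := hΓK.1 hk₁
  -- `g₁ = k₁⁻¹ g` fixes `x` (and the family)
  set g₁ : (V →ₗ[ℚ] V)ˣ := k₁⁻¹ * g with hg₁def
  have hg₁C : C g₁ := hCmul _ _ (hCinv _ hk₁C) hgC
  have hg₁F : F g₁ := hFmul _ _ (hFinv _ hk₁F) hfix
  have hg₁x : (g₁ : V →ₗ[ℚ] V) x = x := by
    rw [hg₁def, Units.val_mul, Module.End.mul_apply, ← hk₁x, localTubeSpan_units_inv_apply_apply]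
  -- Step 2: `g₁ y = y + 2 z₂`, `z₂ ∈ Λ'`, `z₂ ⟂ x`; correct by `E_{x,-z₂}²` and `T_x^{2k}`
  obtain ⟨z₂, hz₂, hz₂e⟩ := hhalfL g₁ hg₁C hg₁F y hyL
  have hz₂L : z₂ ∈ L := hLspan z₂ hz₂
  have hxs : B x ((g₁ : V →ₗ[ℚ] V) y) = 1 := by
    conv_lhs => rw [← hg₁x]
    rw [hg₁C.1, hxy]
  have hxz₂ : B x z₂ = 0 := by
    have h0 : B x ((g₁ : V →ₗ[ℚ] V) y - y) = 0 := by rw [map_sub, hxs, hxy, sub_self]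
    rw [hz₂e, map_smul, smul_eq_mul] at h0
    linarith
  have hnz₂L : -z₂ ∈ L := ⟨Submodule.neg_mem _ hz₂L.1, fun i =>
    ⟨by rw [map_neg, (hz₂L.2 i).1, neg_zero], by rw [map_neg, (hz₂L.2 i).2, neg_zero]⟩⟩
  have hxnz₂ : B x (-z₂) = 0 := by rw [map_neg, hxz₂, neg_zero]
  obtain ⟨p, hp, hpv⟩ := hpairL x hxL (-z₂) hnz₂L hxnz₂
  obtain ⟨q, hq, hqv⟩ := hsqL x hxL
  obtain ⟨kk, hkk⟩ := hintL y hyL z₂ hz₂L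
  set h₂ : (V →ₗ[ℚ] V)ˣ := q ^ kk * p with hh₂def
  have hh₂K : h₂ ∈ ΓK := mul_mem (Subgroup.zpow_mem _ hq kk) hp
  have hpx : ((p : (V →ₗ[ℚ] V)ˣ) : V →ₗ[ℚ] V) x = x := by
    rw [hpv, hB.self_eq_zero x, hxnz₂, zero_smul, zero_smul, add_zero, smul_zero, add_zero]
  have hpy : ((p : (V →ₗ[ℚ] V)ˣ) : V →ₗ[ℚ] V) y = (g₁ : V →ₗ[ℚ] V) y - (2 * (kk : ℚ)) • x := by
    have hyz : B y (-z₂) = -kk := by rw [map_neg, hkk]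
    have e1 : (g₁ : V →ₗ[ℚ] V) y = y + (2 : ℚ) • z₂ := by rw [← hz₂e]; abel
    rw [hpv, hyx, hyz, e1]
    module
  have hh₂x : ((h₂ : (V →ₗ[ℚ] V)ˣ) : V →ₗ[ℚ] V) x = x := by
    rw [hh₂def, Units.val_mul, Module.End.mul_apply, hpx, localTubeSpan_sqMove_zpow_apply B hB x q hqv kk x,
      hB.self_eq_zero x, zero_smul, smul_zero, sub_zero]
  have hh₂y : ((h₂ : (V →ₗ[ℚ] V)ˣ) : V →ₗ[ℚ] V) y = (g₁ : V →ₗ[ℚ] V) y := by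
    rw [hh₂def, Units.val_mul, Module.End.mul_apply, hpy, localTubeSpan_sqMove_zpow_apply B hB x q hqv kk,
      map_sub, map_smul, LinearMap.sub_apply, LinearMap.smul_apply, hB.self_eq_zero x, ← hB.neg_eq x,
      hxs]
    module
  -- the descent element `h := k₁ * h₂`
  obtain ⟨hkG, hkC, hkF⟩ := hΓK.1 (mul_mem hk₁ hh₂K)
  refine ⟨k₁ * h₂, hkG, hkC, hkF, ?_, ?_⟩
  · rw [mul_inv_rev, mul_assoc, ← hg₁def, Units.val_mul, Module.End.mul_apply, hg₁x, ← hh₂x,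
      localTubeSpan_units_inv_apply_apply, hh₂x]
  · rw [mul_inv_rev, mul_assoc, ← hg₁def, Units.val_mul, Module.End.mul_apply, ← hh₂y,
      localTubeSpan_units_inv_apply_apply]

end Summit.HodgeConjecture.HodgeConjecture.Theorems

end
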